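import Summits.QuantumFields.BalabanUV.Beta.D1BFx.KCombineCovColour
import Summits.QuantumFields.BalabanUV.Beta.D1BFx.KCombineCovTowers
import Summits.QuantumFields.BalabanUV.Beta.D1BFx.TorusGaugeBasisTranspose

/-!
# `BalabanUV.Beta.D1BFx.KCombineCovColourTorus` — road «BF-x» for binder row D1, slot (K), (K) CLOSURE PLAN (R1-L) §2 (A1): **«K-COV-C» PART 2 —
# THE TWIST IS INVISIBLE AT A PRODUCT-FORM WEIGHT, AND THE STRIPPED DICTIONARY STEP PER TORUS.**  PART 1 (`KCombineCovColour`) stripped the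
# (R1-L) slice transfer to the colourless typed jets (signed first jets `tj₂`, TWISTED Gram jets `tgram•`).  Here: (§1) for a PRODUCT-FORM co-frame
# weight `B = TᵀAT` the twisted covariant-Gram one-loop functional EQUALS the honest-formula one — both are `2·hessT((T₀W₀)⁻¹; (TW)•) + hessT(A₀⁻¹; A•)`
# (K-TA4G's `hessT_gram_split_jets` lifted and stripped; no parity hypothesis at all) — so the LANDED honest-formula readings of the «GRAM-COV» slot
# (`KGramCovJets` p254145, `KCombineCovTowers` §1 p255423) ARE the twisted readings; (§2) the `K`-parts drop from the twisted Gram jets under the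
# ONE-SIDED WARD-L letters; (§3) `KCombineCov.identity_array_currency_cov_What0` RE-RUN on PART 1's `hessT_transfer_wardL_stripped`: the per-torus
# identity in ARRAY currency for PARITY-TYPED jets (`kₛ`, `kₜ`, `Aₛ`, `Aₜ` antisymmetric) with the M-dictionary letters `kkt kₛ qₛ = AM`,
# `kkt kₜ qₜ = AM′`, `kkt kₛₜ qₛₜ · D = AM″` (F-g6-1's placement `V = j·D`, `W = w·D`), the N-letters `tj₂ ỹ• q• = AN•`, `kkt ỹₛₜ qₛₜ = AN″`; (§4) at TB4-W's
# jets: the parity types of the inverse jets (`(Ajet₁)ᵀ = −Ajet₁`, `(Ajet₁₁)ᵀ = Ajet₁₁`) and THE TWISTED «GRAM-COV» READING = the `Cgh` tower of the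
# landed `ℤ⁴` families `Lgh`∕`Lgh₂` (PART 1 of the `hId` hypothesis of `KCombineCovTowers.hessKer_transfer_road_cov_towers` in the stripped currency).

HONEST FRAMING (cell contract, verbatim): «discharging `BetaPertH` makes Bałaban's UV stability UNCONDITIONAL — a real constructive-QFT
result; it is NOT the continuum limit and NOT the Clay problem.»  HONEST DEPENDENCY (verbatim): «continuum YM on T⁴ ⇐ BetaPertH ∧ nine
spine estimates (0/9 proved); BetaPertH ⇐ (D1) ∧ (D4) ∧ CAP+tail; G-an2-4 gates asym, D1 and NE2/3/4.»  THIS MODULE DISCHARGES NOTHING of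
D1 ∕ BetaPertH: [folklore] finite linear algebra and compositions BY NAME (`GramWeightJetsMixed.hessT_gram_split_jets`, the K-TA4C lift lemmas,
PART 1, `KLimitAxial.hessT_inv_MT_corner`, `TorusGaugeBasis.{Khat,Qhat,tauT}_mul_What0`, `TorusGaugeBasisTranspose.Khat_transpose`,
`TorusCombKKT.isUnit_det_MT`, `KGramCovJets.hessT_gramCov_B_eq_Gjet`∕`hessT_Gjet_eq_Cgh_Lsq`, `KCombineCovTowers.Lsq•_fst_eq_arr`).  No `def`,
no `def … : Prop`, nothing cited, 0 sorry.  It does NOT decide the table dictionary (A2-M∕N), does NOT prove WARD-L (Q1), does NOT touch the END.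
NOT summit progress; NOT BetaPertH, NOT continuum, NOT Clay.

ABSOLUTE RULE (cell, verbatim): «No internally-minted statement may enter as a cited fact. Every hypothesis is either kernel-proved in this
package or a verbatim quotation of a PUBLISHED theorem with page reference. The manuscript(s) under audit are NOT citable for their own
disputed steps — they are the thing under adjudication; programme-internal (2001/route/tribunal) claims are never citable.»

CONTENT (all [folklore]).
* §1 `lift_jet₁`, `lift_jetMix`; **`hessT_tgram_split_jets`** (`hessT (Φ₀⁻¹; tgram₁ W₀ Wₛ B₀ B̃ₛ, tgram₁ W₀ Wₜ B₀ B̃ₜ, tgramMix W• B₀ B̃•) = 2·hessT ((T₀W₀)⁻¹; (TW)•)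
  + hessT (A₀⁻¹; Aₛ, Aₜ, Aₛₜ)`, `B₀ = gram₀ T₀ A₀`, `B̃ₛ = tgram₁ T₀ Tₛ A₀ Aₛ`, `B̃ₛₜ = tgramMix T A`); **`hessT_tgram_eq_gram`** (twisted functional = honest-formula functional).
* §2 `gram₀_add_of_wardL`, **`tgram₁_add_eq_of_wardL`**, **`tgramMix_add_eq_of_wardL`** — the `K`-parts drop under `K₀W₀ = 0` and the ONE-SIDED letters.
* §3 `tj₂_mul_sgn`; **`identity_array_currency_cov_What0_stripped`** — the stripped per-torus dictionary step (generic `d`, `n`, `p`, `r`).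
* §4 `transpose_Gjet₁₁`, `transpose_Ajet₀`, **`transpose_Ajet₁`** (odd), **`transpose_Ajet₁₁`** (even); **`hessT_tgramCov_What0_eq_arr`** — at TB4-W's jets +
  THE CONVENTION's gauge jets, under the one-sided WARD-L letters, for `|u−u′|₁ + 3 ≤ s`:
  `hessT ((gram₀ Ŵ₀ (K̂+B₀))⁻¹; tgram₁ Ŵ₀ Wₛ (K̂+B₀) (kₛ+B̃ₛ), …, tgramMix …) = hessT ((Cgh (m+1) a)^; (arr Lgh μ u)^, (arr Lgh ν u′)^, (arr Lgh₂ μ u ν u′)^)`.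
Unit `b2b-balaban-beta-d1-formalise-leaf-03` (gen 11); road owner `b2b-balaban-beta-d1-p2`.
-/

noncomputable section

namespace Summit.QuantumFields.BalabanUV.Beta.D1BFx.KCombineCovColourTorus

open Matrix
open scoped Kronecker
open Literature.MathematicalPhysics.QuantumFieldTheory.Balaban1983to89
open Literature.MathematicalPhysics.QuantumFieldTheory.Balaban1983to89.Beta
open Literature.MathematicalPhysics.QuantumFieldTheory.Balaban1983to89.Beta.Composition (kkt)
open B12Sec2to5 (l1)
open ExpKernelCalculus (MKer)
open AffineAveraging (box toSite)
open OneStepResolventKernel (Fib)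
open OneStepKernelFamily (KInvStep)
open Summit.QuantumFields.BalabanUV.Beta.AxialDressingRooted (coDressKBmAt)
open Summit.QuantumFields.BalabanUV.Beta.D1BFx.FibredPeriodisation (periodiseF)
open Summit.QuantumFields.BalabanUV.Beta.D1BFx.SortedKernels (blocksHat)
open Summit.QuantumFields.BalabanUV.Beta.D1BFx.SortedPack (sortK)
open Summit.QuantumFields.BalabanUV.Beta.D1BFx.SortedEmbedding (e₁)
open Summit.QuantumFields.BalabanUV.Beta.D1BFx.PeriodicArrays (arr toF)
open Summit.QuantumFields.BalabanUV.Beta.D1BFx.MixedVarPackedHess (hessT)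
open Summit.QuantumFields.BalabanUV.Beta.D1BFx.GramWeightJets (gram₀ gram₁)
open Summit.QuantumFields.BalabanUV.Beta.D1BFx.GramWeightJetsMixed (gramMix hessT_gram_split_jets)
open Summit.QuantumFields.BalabanUV.Beta.D1BFx.GramWeightColourLift (tj₂ tgram₁ tgramMix gramPhi_lift₀ gramPhi_lift₁ gramPhi_liftMix lift_mul)
open Summit.QuantumFields.BalabanUV.Beta.D1BFx.ColourLift
open Summit.QuantumFields.BalabanUV.Beta.D1BFx.ColourLiftPackedHess (tj₂_eq_kkt_mul_sgn sgn_mul_sgn)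
open Summit.QuantumFields.BalabanUV.Beta.D1BFx.KCombineCovColour (inv_one_kronecker hessT_transfer_wardL_stripped)
open Summit.QuantumFields.BalabanUV.Beta.D1BFx.TorusCombKKT (I J CombRows tauT Khat Qhat isUnit_det_MT)
open Summit.QuantumFields.BalabanUV.Beta.D1BFx.TorusGaugeBasis (What0 tauT_mul_What0 Khat_mul_What0 Qhat_mul_What0)
open Summit.QuantumFields.BalabanUV.Beta.D1BFx.TorusGaugeBasisTranspose (Khat_transpose)
open Summit.QuantumFields.BalabanUV.Beta.D1BFx.TorusGaugeBasisMatrix (Nhat)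
open Summit.QuantumFields.BalabanUV.Beta.D1BFx.KLimitAxial (hessT_inv_MT_corner)
open Summit.QuantumFields.BalabanUV.Beta.D1BFx.PeriodisedProjector (Lhat)
open Summit.QuantumFields.BalabanUV.Beta.D1BFx.TorusGaugeWeight (Lhat_transpose)
open Summit.QuantumFields.BalabanUV.Beta.D1BFx.TorusCoframeJets (Djet Ljet Ljet₁₁ Tjet₀ Tjet₁ Tjet₁₁ Gjet₀ Gjet₁ Gjet₁₁ Ajet₀ Ajet₁ Ajet₁₁
  transpose_Ljet transpose_Ljet₁₁ transpose_Gjet₀ transpose_Gjet₁)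
open Summit.QuantumFields.BalabanUV.Beta.D1BFx.KGhostLeg (Cgh)
open Summit.QuantumFields.BalabanUV.Beta.D1BFx.TorusGhostWordArrays (Lgh)
open Summit.QuantumFields.BalabanUV.Beta.D1BFx.TorusGhostPairStencils (Lgh₂)
open Summit.QuantumFields.BalabanUV.Beta.D1BFx.KCombineCovLegs (det_Tjet₀_mul_What0_ne_zero det_Ajet₀_Nhat_ne_zero)
open Summit.QuantumFields.BalabanUV.Beta.D1BFx.KGramCovJets (hessT_gramCov_B_eq_Gjet hessT_Gjet_eq_Cgh_Lsq)
open Summit.QuantumFields.BalabanUV.Beta.D1BFx.KCombineCovTowers (Lsq₁_fst_eq_arr Lsq₁₁_fst_eq_arr)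

/-! ## §1 The twist is invisible at a product-form weight -/

section Split

variable {l ν ρ : Type*} [Fintype l] [Fintype ν] [Fintype ρ] [DecidableEq l] [DecidableEq ρ]

omit [Fintype ρ] [DecidableEq ρ] in
/-- [folklore] The lifted first product jet: `(c⊗x)(1⊗W₀) + (1⊗X₀)(c⊗w) = c ⊗ (xW₀ + X₀w)`. -/
theorem lift_jet₁ {α : Type*} (c : Matrix l l ℝ) (X₀ x : Matrix α ν ℝ) (W₀ w : Matrix ν ρ ℝ) :
    (c ⊗ₖ x) * ((1 : Matrix l l ℝ) ⊗ₖ W₀) + ((1 : Matrix l l ℝ) ⊗ₖ X₀) * (c ⊗ₖ w) = c ⊗ₖ (x * W₀ + X₀ * w) := by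
  rw [← Matrix.mul_kronecker_mul, ← Matrix.mul_kronecker_mul, Matrix.mul_one, Matrix.one_mul, ← Matrix.kronecker_add]

omit [Fintype ρ] [DecidableEq ρ] in
/-- [folklore] The lifted mixed product jet: `c·c` on the second jets, `c` on the first. -/
theorem lift_jetMix {α : Type*} (c : Matrix l l ℝ) (X₀ xₛ xₜ xₛₜ : Matrix α ν ℝ) (W₀ wₛ wₜ wₛₜ : Matrix ν ρ ℝ) :
    ((c * c) ⊗ₖ xₛₜ) * ((1 : Matrix l l ℝ) ⊗ₖ W₀) + (c ⊗ₖ xₛ) * (c ⊗ₖ wₜ) + (c ⊗ₖ xₜ) * (c ⊗ₖ wₛ)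
        + ((1 : Matrix l l ℝ) ⊗ₖ X₀) * ((c * c) ⊗ₖ wₛₜ)
      = (c * c) ⊗ₖ (xₛₜ * W₀ + xₛ * wₜ + xₜ * wₛ + X₀ * wₛₜ) := by
  rw [← Matrix.mul_kronecker_mul, ← Matrix.mul_kronecker_mul, ← Matrix.mul_kronecker_mul, ← Matrix.mul_kronecker_mul,
    Matrix.mul_one, Matrix.one_mul, ← Matrix.kronecker_add, ← Matrix.kronecker_add, ← Matrix.kronecker_add]

variable {c : Matrix l l ℝ}

/-- [folklore] **THE TWISTED PRODUCT-FORM SPLIT, UP TO `tr(c·c)`**: K-TA4G's `hessT_gram_split_jets` at the lifted data `1⊗T₀, c⊗Tₛ, (c·c)⊗Tₛₜ, …`,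
every slot read back through the lift lemmas. -/
theorem hessT_tgram_split_jets_mul (hc : cᵀ = -c) (T₀ Tₛ Tₜ Tₛₜ : Matrix ρ ν ℝ) (A₀ Aₛ Aₜ Aₛₜ : Matrix ρ ρ ℝ) (W₀ Wₛ Wₜ Wₛₜ : Matrix ν ρ ℝ)
    (hT : (T₀ * W₀).det ≠ 0) (hA : A₀.det ≠ 0) :
    (c * c).trace * hessT (gram₀ W₀ (gram₀ T₀ A₀))⁻¹ (tgram₁ W₀ Wₛ (gram₀ T₀ A₀) (tgram₁ T₀ Tₛ A₀ Aₛ))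
        (tgram₁ W₀ Wₜ (gram₀ T₀ A₀) (tgram₁ T₀ Tₜ A₀ Aₜ))
        (tgramMix W₀ Wₛ Wₜ Wₛₜ (gram₀ T₀ A₀) (tgram₁ T₀ Tₛ A₀ Aₛ) (tgram₁ T₀ Tₜ A₀ Aₜ) (tgramMix T₀ Tₛ Tₜ Tₛₜ A₀ Aₛ Aₜ Aₛₜ))
      = (c * c).trace * (2 * hessT (T₀ * W₀)⁻¹ (Tₛ * W₀ + T₀ * Wₛ) (Tₜ * W₀ + T₀ * Wₜ) (Tₛₜ * W₀ + Tₛ * Wₜ + Tₜ * Wₛ + T₀ * Wₛₜ)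
          + hessT A₀⁻¹ Aₛ Aₜ Aₛₜ) := by
  have h := hessT_gram_split_jets ((1 : Matrix l l ℝ) ⊗ₖ T₀) (c ⊗ₖ Tₛ) (c ⊗ₖ Tₜ) 0 0 ((c * c) ⊗ₖ Tₛₜ)
    ((1 : Matrix l l ℝ) ⊗ₖ A₀) (c ⊗ₖ Aₛ) (c ⊗ₖ Aₜ) 0 0 ((c * c) ⊗ₖ Aₛₜ)
    ((1 : Matrix l l ℝ) ⊗ₖ W₀) (c ⊗ₖ Wₛ) (c ⊗ₖ Wₜ) 0 0 ((c * c) ⊗ₖ Wₛₜ) (det_lift_mul_ne_zero hT) (det_one_kronecker_ne_zero hA)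
  rw [gramPhi_lift₀, gramPhi_lift₁ hc, gramPhi_lift₁ hc, gramPhi_liftMix hc, inv_one_kronecker, hessT_kronecker_lift,
    lift_jet₁, lift_jet₁, lift_jetMix, lift_mul, inv_one_kronecker, hessT_kronecker_lift, inv_one_kronecker, hessT_kronecker_lift] at h
  linear_combination h

/-- [folklore] **THE TWISTED PRODUCT-FORM SPLIT** (`c = cgen`): `hessT (Φ₀⁻¹; Φ̃ₛ, Φ̃ₜ, Φ̃ₛₜ) = 2·hessT ((T₀W₀)⁻¹; (TW)ₛ, (TW)ₜ, (TW)ₛₜ) + hessT (A₀⁻¹; Aₛ, Aₜ, Aₛₜ)`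
for the TWISTED Gram jets `Φ̃ₛ = tgram₁ W₀ Wₛ B₀ B̃ₛ`, `B̃ₛ = tgram₁ T₀ Tₛ A₀ Aₛ`, `Φ̃ₛₜ = tgramMix …` of the product form `Φ = (TW)ᵀA(TW)` — the SAME right-hand
side as the honest `hessT_gram_split_jets`; no parity hypothesis. -/
theorem hessT_tgram_split_jets (T₀ Tₛ Tₜ Tₛₜ : Matrix ρ ν ℝ) (A₀ Aₛ Aₜ Aₛₜ : Matrix ρ ρ ℝ) (W₀ Wₛ Wₜ Wₛₜ : Matrix ν ρ ℝ)
    (hT : (T₀ * W₀).det ≠ 0) (hA : A₀.det ≠ 0) :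
    hessT (gram₀ W₀ (gram₀ T₀ A₀))⁻¹ (tgram₁ W₀ Wₛ (gram₀ T₀ A₀) (tgram₁ T₀ Tₛ A₀ Aₛ)) (tgram₁ W₀ Wₜ (gram₀ T₀ A₀) (tgram₁ T₀ Tₜ A₀ Aₜ))
        (tgramMix W₀ Wₛ Wₜ Wₛₜ (gram₀ T₀ A₀) (tgram₁ T₀ Tₛ A₀ Aₛ) (tgram₁ T₀ Tₜ A₀ Aₜ) (tgramMix T₀ Tₛ Tₜ Tₛₜ A₀ Aₛ Aₜ Aₛₜ))
      = 2 * hessT (T₀ * W₀)⁻¹ (Tₛ * W₀ + T₀ * Wₛ) (Tₜ * W₀ + T₀ * Wₜ) (Tₛₜ * W₀ + Tₛ * Wₜ + Tₜ * Wₛ + T₀ * Wₛₜ)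
        + hessT A₀⁻¹ Aₛ Aₜ Aₛₜ := by
  have h := hessT_tgram_split_jets_mul cgen_transpose T₀ Tₛ Tₜ Tₛₜ A₀ Aₛ Aₜ Aₛₜ W₀ Wₛ Wₜ Wₛₜ hT hA
  rw [trace_cgen_mul_cgen] at h
  linarith

/-- [folklore] **THE TWIST IS INVISIBLE AT A PRODUCT-FORM WEIGHT**: the twisted covariant-Gram one-loop functional equals the honest-formula one,
`hessT (Φ₀⁻¹; tgram•(W•, gram₀ T₀ A₀, tgram•(T•, A•))) = hessT (Φ₀⁻¹; gram•(W•, gram₀ T₀ A₀, gram•(T•, A•)))` (both are the split of §1). -/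
theorem hessT_tgram_eq_gram (T₀ Tₛ Tₜ Tₛₜ : Matrix ρ ν ℝ) (A₀ Aₛ Aₜ Aₛₜ : Matrix ρ ρ ℝ) (W₀ Wₛ Wₜ Wₛₜ : Matrix ν ρ ℝ)
    (hT : (T₀ * W₀).det ≠ 0) (hA : A₀.det ≠ 0) :
    hessT (gram₀ W₀ (gram₀ T₀ A₀))⁻¹ (tgram₁ W₀ Wₛ (gram₀ T₀ A₀) (tgram₁ T₀ Tₛ A₀ Aₛ)) (tgram₁ W₀ Wₜ (gram₀ T₀ A₀) (tgram₁ T₀ Tₜ A₀ Aₜ))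
        (tgramMix W₀ Wₛ Wₜ Wₛₜ (gram₀ T₀ A₀) (tgram₁ T₀ Tₛ A₀ Aₛ) (tgram₁ T₀ Tₜ A₀ Aₜ) (tgramMix T₀ Tₛ Tₜ Tₛₜ A₀ Aₛ Aₜ Aₛₜ))
      = hessT (gram₀ W₀ (gram₀ T₀ A₀))⁻¹ (gram₁ W₀ Wₛ (gram₀ T₀ A₀) (gram₁ T₀ Tₛ A₀ Aₛ)) (gram₁ W₀ Wₜ (gram₀ T₀ A₀) (gram₁ T₀ Tₜ A₀ Aₜ))
        (gramMix W₀ Wₛ Wₜ Wₛₜ (gram₀ T₀ A₀) (gram₁ T₀ Tₛ A₀ Aₛ) (gram₁ T₀ Tₜ A₀ Aₜ) (gramMix T₀ Tₛ Tₜ Tₛₜ A₀ Aₛ Aₜ Aₛₜ)) := by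
  rw [hessT_tgram_split_jets T₀ Tₛ Tₜ Tₛₜ A₀ Aₛ Aₜ Aₛₜ W₀ Wₛ Wₜ Wₛₜ hT hA,
    hessT_gram_split_jets T₀ Tₛ Tₜ 0 0 Tₛₜ A₀ Aₛ Aₜ 0 0 Aₛₜ W₀ Wₛ Wₜ 0 0 Wₛₜ hT hA]

end Split

/-! ## §2 The `K`-parts drop from the twisted Gram jets under the ONE-SIDED letters -/

section WardL

variable {ν κ : Type*} [Fintype ν]
variable {K₀ Kₛ Kₜ Kₛₜ B₀ Bₛ Bₜ Bₛₜ : Matrix ν ν ℝ} {W₀ Wₛ Wₜ Wₛₜ : Matrix ν κ ℝ}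

/-- [folklore] Order 0: `gram₀ W₀ (K₀ + B₀) = gram₀ W₀ B₀` under `K₀W₀ = 0`. -/
theorem gram₀_add_of_wardL (hE₀ : K₀ * W₀ = 0) : gram₀ W₀ (K₀ + B₀) = gram₀ W₀ B₀ := by
  rw [gram₀, gram₀, Matrix.mul_add, Matrix.add_mul, Matrix.mul_assoc _ K₀, hE₀, Matrix.mul_zero, zero_add]

/-- [folklore] **First order, TWISTED**: `tgram₁ W₀ Wₛ (K₀+B₀) (Kₛ+Bₛ) = tgram₁ W₀ Wₛ B₀ Bₛ` under `K₀W₀ = 0` and the ONE-SIDED letter `KₛW₀ + K₀Wₛ = 0`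
(no transposed letter, no parity needed: the `K`-part is `−WₛᵀK₀W₀ + W₀ᵀ(KₛW₀ + K₀Wₛ)`). -/
theorem tgram₁_add_eq_of_wardL (hE₀ : K₀ * W₀ = 0) (hEₛ : Kₛ * W₀ + K₀ * Wₛ = 0) :
    tgram₁ W₀ Wₛ (K₀ + B₀) (Kₛ + Bₛ) = tgram₁ W₀ Wₛ B₀ Bₛ := by
  have h1 : W₀ᵀ * Kₛ * W₀ + W₀ᵀ * K₀ * Wₛ = 0 := by
    rw [Matrix.mul_assoc, Matrix.mul_assoc, ← Matrix.mul_add, hEₛ, Matrix.mul_zero]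
  rw [tgram₁, tgram₁, Matrix.mul_add, Matrix.add_mul, Matrix.mul_assoc _ K₀ W₀, hE₀, Matrix.mul_zero, zero_add, Matrix.mul_add,
    Matrix.add_mul, Matrix.mul_add, Matrix.add_mul]
  rw [show -(Wₛᵀ * B₀ * W₀) + (W₀ᵀ * Kₛ * W₀ + W₀ᵀ * Bₛ * W₀) + (W₀ᵀ * K₀ * Wₛ + W₀ᵀ * B₀ * Wₛ)
      = (W₀ᵀ * Kₛ * W₀ + W₀ᵀ * K₀ * Wₛ) + (-(Wₛᵀ * B₀ * W₀) + W₀ᵀ * Bₛ * W₀ + W₀ᵀ * B₀ * Wₛ) by abel, h1, zero_add]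

/-- [folklore] **Mixed order, TWISTED**: `tgramMix W• (K₀+B₀) (Kₛ+Bₛ) (Kₜ+Bₜ) (Kₛₜ+Bₛₜ) = tgramMix W• B₀ Bₛ Bₜ Bₛₜ` under `K₀W₀ = 0` and the ONE-SIDED letters
`KₛW₀ + K₀Wₛ = 0`, `KₜW₀ + K₀Wₜ = 0`, `KₛₜW₀ + KₛWₜ + KₜWₛ + K₀Wₛₜ = 0` (the `K`-part is `WₛₜᵀK₀W₀ − Wₛᵀ(KₜW₀+K₀Wₜ) − Wₜᵀ(KₛW₀+K₀Wₛ) + W₀ᵀ(KₛₜW₀+KₛWₜ+KₜWₛ+K₀Wₛₜ)`). -/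
theorem tgramMix_add_eq_of_wardL (hE₀ : K₀ * W₀ = 0) (hEₛ : Kₛ * W₀ + K₀ * Wₛ = 0) (hEₜ : Kₜ * W₀ + K₀ * Wₜ = 0)
    (hEₛₜ : Kₛₜ * W₀ + Kₛ * Wₜ + Kₜ * Wₛ + K₀ * Wₛₜ = 0) :
    tgramMix W₀ Wₛ Wₜ Wₛₜ (K₀ + B₀) (Kₛ + Bₛ) (Kₜ + Bₜ) (Kₛₜ + Bₛₜ) = tgramMix W₀ Wₛ Wₜ Wₛₜ B₀ Bₛ Bₜ Bₛₜ := by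
  have h0 : Wₛₜᵀ * K₀ * W₀ = 0 := by rw [Matrix.mul_assoc, hE₀, Matrix.mul_zero]
  have hs : Wₜᵀ * Kₛ * W₀ + Wₜᵀ * K₀ * Wₛ = 0 := by rw [Matrix.mul_assoc, Matrix.mul_assoc, ← Matrix.mul_add, hEₛ, Matrix.mul_zero]
  have ht : Wₛᵀ * Kₜ * W₀ + Wₛᵀ * K₀ * Wₜ = 0 := by rw [Matrix.mul_assoc, Matrix.mul_assoc, ← Matrix.mul_add, hEₜ, Matrix.mul_zero]
  have hm : W₀ᵀ * Kₛₜ * W₀ + W₀ᵀ * Kₛ * Wₜ + W₀ᵀ * Kₜ * Wₛ + W₀ᵀ * K₀ * Wₛₜ = 0 := by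
    rw [Matrix.mul_assoc, Matrix.mul_assoc, Matrix.mul_assoc, Matrix.mul_assoc, ← Matrix.mul_add, ← Matrix.mul_add, ← Matrix.mul_add, hEₛₜ,
      Matrix.mul_zero]
  simp only [tgramMix, Matrix.mul_add, Matrix.add_mul, neg_add]
  rw [show Wₛₜᵀ * K₀ * W₀ + Wₛₜᵀ * B₀ * W₀ + (-(Wₛᵀ * Kₜ * W₀) + -(Wₛᵀ * Bₜ * W₀)) + (-(Wₜᵀ * Kₛ * W₀) + -(Wₜᵀ * Bₛ * W₀))
        + (W₀ᵀ * Kₛₜ * W₀ + W₀ᵀ * Bₛₜ * W₀) + (-(Wₛᵀ * K₀ * Wₜ) + -(Wₛᵀ * B₀ * Wₜ)) + (-(Wₜᵀ * K₀ * Wₛ) + -(Wₜᵀ * B₀ * Wₛ))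
        + (W₀ᵀ * Kₛ * Wₜ + W₀ᵀ * Bₛ * Wₜ) + (W₀ᵀ * Kₜ * Wₛ + W₀ᵀ * Bₜ * Wₛ) + (W₀ᵀ * K₀ * Wₛₜ + W₀ᵀ * B₀ * Wₛₜ)
      = Wₛₜᵀ * K₀ * W₀ - (Wₛᵀ * Kₜ * W₀ + Wₛᵀ * K₀ * Wₜ) - (Wₜᵀ * Kₛ * W₀ + Wₜᵀ * K₀ * Wₛ)
        + (W₀ᵀ * Kₛₜ * W₀ + W₀ᵀ * Kₛ * Wₜ + W₀ᵀ * Kₜ * Wₛ + W₀ᵀ * K₀ * Wₛₜ)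
        + (Wₛₜᵀ * B₀ * W₀ + -(Wₛᵀ * Bₜ * W₀) + -(Wₜᵀ * Bₛ * W₀) + W₀ᵀ * Bₛₜ * W₀ + -(Wₛᵀ * B₀ * Wₜ) + -(Wₜᵀ * B₀ * Wₛ)
          + W₀ᵀ * Bₛ * Wₜ + W₀ᵀ * Bₜ * Wₛ + W₀ᵀ * B₀ * Wₛₜ) by abel,
    h0, hs, ht, hm]
  abel

end WardL

/-! ## §3 The stripped dictionary step, per torus -/

section Dictionary

variable {ν μ : Type*} [Fintype ν] [Fintype μ] [DecidableEq ν] [DecidableEq μ]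

/-- [folklore] `tj₂ k q · D = kkt k q` (`D = diag(1,−1)`, `D² = 1`): the signed first jet read through the placement is the PLAIN bordered jet. -/
theorem tj₂_mul_sgn (k : Matrix ν ν ℝ) (q : Matrix μ ν ℝ) :
    tj₂ k q * Matrix.fromBlocks (1 : Matrix ν ν ℝ) 0 0 (-1 : Matrix μ μ ℝ) = kkt k q := by
  rw [tj₂_eq_kkt_mul_sgn, Matrix.mul_assoc, sgn_mul_sgn, Matrix.mul_one]

variable {d n : ℕ} [NeZero n] {r : Fin (d + 1) → ℕ} (p : ℕ) [NeZero p]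

/-- [folklore] **THE STRIPPED DICTIONARY STEP AT THE ROOTED GAUGE BASIS `W₀ := Ŵ₀`** — `KCombineCov.identity_array_currency_cov_What0` RE-RUN on PART 1's
`hessT_transfer_wardL_stripped`.  PARITY-TYPED jets: `kₛ`, `kₜ`, `Aₛ`, `Aₜ` ANTISYMMETRIC, `kₛₜ`, `A₀`, `Aₛₜ` symmetric (`K̂ᵀ = K̂` is the tree's
`Khat_transpose`); the order-0 letters `K̂Ŵ₀ = 0`, `Q̂Ŵ₀ = 0`, `τ_TŴ₀ = 1` BY NAME; HYPOTHESES = the ONE-SIDED WARD-L letters for `k•` against the gauge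
jets `w•`, the kinematic letters for `q•`, `det(T₀Ŵ₀)`, `det A₀`, `det Φ₀ ≠ 0`, and the DICTIONARY letters — M-side in F-g6-1's placement
(`kkt kₛ qₛ = AM`, `kkt kₜ qₜ = AM′`, `kkt kₛₜ qₛₜ · D = AM″`), N-LEG `(kkt (K̂ + T₀ᵀA₀T₀) Q̂)⁻¹ = blocksHat p (sortK n NL)`, N-jets `tj₂ ỹₛ qₛ = AN`,
`tj₂ ỹₜ qₜ = AN′`, `kkt ỹₛₜ qₛₜ = AN″` (`ỹₛ = kₛ + tgram₁ T₀ tₛ A₀ Aₛ`, `ỹₛₜ = kₛₜ + tgramMix T A`), the TWISTED covariant-Gram functional `= bΦ`,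
the comb-FP functional `hessT 1 (τ_T w•) = eτ`.  CONCLUSION: `hessT (blocksHat p (sortK n G_M); AM•) + bΦ = hessT (blocksHat p (sortK n NL); AN•) + 2·eτ`. -/
theorem identity_array_currency_cov_What0_stripped (hr : r ∈ box (d + 1) n)
    (kₛ kₜ kₛₜ : Matrix (I d n p) (I d n p) ℝ)
    (T₀ tₛ tₜ tₛₜ : Matrix (CombRows (toSite r) n p) (I d n p) ℝ)
    (A₀ Aₛ Aₜ Aₛₜ : Matrix (CombRows (toSite r) n p) (CombRows (toSite r) n p) ℝ)
    (wₛ wₜ wₛₜ : Matrix (I d n p) (CombRows (toSite r) n p) ℝ) (qₛ qₜ qₛₜ : Matrix (J d p) (I d n p) ℝ)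
    (hkₛ : kₛᵀ = -kₛ) (hkₜ : kₜᵀ = -kₜ) (hkₛₜ : kₛₜᵀ = kₛₜ)
    (hA₀ : A₀ᵀ = A₀) (hAₛ : Aₛᵀ = -Aₛ) (hAₜ : Aₜᵀ = -Aₜ) (hAₛₜ : Aₛₜᵀ = Aₛₜ)
    (aₛ : kₛ * What0 r n p + Khat (d := d) n p * wₛ = 0) (aₜ : kₜ * What0 r n p + Khat (d := d) n p * wₜ = 0)
    (aₛₜ : kₛₜ * What0 r n p + kₛ * wₜ + kₜ * wₛ + Khat (d := d) n p * wₛₜ = 0)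
    (bₛ : qₛ * What0 r n p + Qhat (d := d) n p * wₛ = 0) (bₜ : qₜ * What0 r n p + Qhat (d := d) n p * wₜ = 0)
    (bₛₜ : qₛₜ * What0 r n p + qₛ * wₜ + qₜ * wₛ + Qhat (d := d) n p * wₛₜ = 0)
    (hTW : (T₀ * What0 r n p).det ≠ 0) (hA : A₀.det ≠ 0) (hΦ : (gram₀ (What0 r n p) (Khat (d := d) n p + gram₀ T₀ A₀)).det ≠ 0)
    {NL : MKer (d + 1) (Fib d)} (AM AM' AM'' AN AN' AN'' : Matrix (I d n p ⊕ J d p) (I d n p ⊕ J d p) ℝ) (bΦ eτ : ℝ)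
    (hJM : kkt kₛ qₛ = AM) (hJM' : kkt kₜ qₜ = AM')
    (hJM'' : kkt kₛₜ qₛₜ * Matrix.fromBlocks (1 : Matrix (I d n p) (I d n p) ℝ) 0 0 (-1 : Matrix (J d p) (J d p) ℝ) = AM'')
    (hLN : (kkt (Khat (d := d) n p + gram₀ T₀ A₀) (Qhat (d := d) n p))⁻¹ = blocksHat p (sortK n NL))
    (hJN : tj₂ (kₛ + tgram₁ T₀ tₛ A₀ Aₛ) qₛ = AN) (hJN' : tj₂ (kₜ + tgram₁ T₀ tₜ A₀ Aₜ) qₜ = AN')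
    (hJN'' : kkt (kₛₜ + tgramMix T₀ tₛ tₜ tₛₜ A₀ Aₛ Aₜ Aₛₜ) qₛₜ = AN'')
    (hbΦ : hessT (gram₀ (What0 r n p) (Khat (d := d) n p + gram₀ T₀ A₀))⁻¹
          (tgram₁ (What0 r n p) wₛ (Khat (d := d) n p + gram₀ T₀ A₀) (kₛ + tgram₁ T₀ tₛ A₀ Aₛ))
          (tgram₁ (What0 r n p) wₜ (Khat (d := d) n p + gram₀ T₀ A₀) (kₜ + tgram₁ T₀ tₜ A₀ Aₜ))
          (tgramMix (What0 r n p) wₛ wₜ wₛₜ (Khat (d := d) n p + gram₀ T₀ A₀) (kₛ + tgram₁ T₀ tₛ A₀ Aₛ) (kₜ + tgram₁ T₀ tₜ A₀ Aₜ)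
            (kₛₜ + tgramMix T₀ tₛ tₜ tₛₜ A₀ Aₛ Aₜ Aₛₜ)) = bΦ)
    (heτ : hessT (1 : Matrix (CombRows (toSite r) n p) (CombRows (toSite r) n p) ℝ)
          (tauT (toSite r) n p * wₛ) (tauT (toSite r) n p * wₜ) (tauT (toSite r) n p * wₛₜ) = eτ) :
    hessT (blocksHat p (sortK n (coDressKBmAt (toSite r) n (KInvStep (d := d) n 0)))) AM AM' AM'' + bΦ
      = hessT (blocksHat p (sortK n NL)) AN AN' AN'' + 2 * eτ := by
  have hτ1 : tauT (toSite r) n p * What0 r n p = 1 := tauT_mul_What0 r n p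
  have hτ : (tauT (toSite r) n p * What0 r n p).det ≠ 0 := by rw [hτ1, Matrix.det_one]; exact one_ne_zero
  have h := hessT_transfer_wardL_stripped (Khat (d := d) n p) kₛ kₜ kₛₜ T₀ tₛ tₜ tₛₜ A₀ Aₛ Aₜ Aₛₜ (What0 r n p) wₛ wₜ wₛₜ
    (Qhat (d := d) n p) qₛ qₜ qₛₜ (tauT (toSite r) n p) (Khat_transpose n p) hkₛ hkₜ hkₛₜ hA₀ hAₛ hAₜ hAₛₜ
    (Khat_mul_What0 r n p hr) aₛ aₜ aₛₜ (Qhat_mul_What0 r n p hr) bₛ bₜ bₛₜ hTW hA hΦ hτ (isUnit_det_MT (d := d) hr p).ne_zero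
  rw [hessT_inv_MT_corner hr p, tj₂_mul_sgn, tj₂_mul_sgn, hJM, hJM', hJM'', hLN, hJN, hJN', hJN'', hbΦ, hτ1, inv_one, heτ] at h
  exact h

end Dictionary

/-! ## §4 At TB4-W's jets: parity types of the inverse jets, and the twisted «GRAM-COV» reading -/

section CoframeParity

variable (s : ℕ) [NeZero s] (b b' : Site 4 s × Fin 4) {ρ : Type*} [Fintype ρ] [DecidableEq ρ] (N : Matrix (Site 4 s) ρ ℝ)

omit [Fintype ρ] [DecidableEq ρ] in
/-- [folklore] PARITY TYPE: the mixed Gram jet is EVEN, `(G_st)ᵀ = G_st` (`Ljetᵀ = −Ljet` twice, `Ljet₁₁ᵀ = Ljet₁₁`, `L̂ᵀ = L̂`). -/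
theorem transpose_Gjet₁₁ : (Gjet₁₁ s b b' N)ᵀ = Gjet₁₁ s b b' N := by
  rw [Gjet₁₁, Matrix.transpose_mul, Matrix.transpose_mul, Matrix.transpose_transpose]
  simp only [Matrix.transpose_add, Matrix.transpose_mul, transpose_Ljet, transpose_Ljet₁₁, Lhat_transpose, neg_mul_neg]
  rw [show Lhat s * Ljet₁₁ s b b' + Ljet s b' * Ljet s b + Ljet s b * Ljet s b' + Ljet₁₁ s b b' * Lhat s
      = Ljet₁₁ s b b' * Lhat s + Ljet s b * Ljet s b' + Ljet s b' * Ljet s b + Lhat s * Ljet₁₁ s b b' by abel, Matrix.mul_assoc]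

/-- [folklore] `(A₀)ᵀ = A₀`. -/
theorem transpose_Ajet₀ : (Ajet₀ s N)ᵀ = Ajet₀ s N := by
  rw [Ajet₀, Matrix.transpose_smul, Matrix.transpose_nonsing_inv, transpose_Gjet₀]

/-- [folklore] PARITY TYPE: **THE FIRST INVERSE JET IS ODD**, `(A_s)ᵀ = −A_s` — the hypothesis `Aₛᵀ = Aₛ` of the honest `KCombineCov` §2∕§3′ FAILS at
TB4-W's jets; the stripped PART 1 ∕ §3 take `Aₛᵀ = −Aₛ`. -/
theorem transpose_Ajet₁ : (Ajet₁ s b N)ᵀ = -Ajet₁ s b N := by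
  have hG : ((Gjet₀ s N)⁻¹)ᵀ = (Gjet₀ s N)⁻¹ := by rw [Matrix.transpose_nonsing_inv, transpose_Gjet₀]
  rw [Ajet₁]
  simp only [Matrix.transpose_neg, Matrix.transpose_smul, Matrix.transpose_mul, hG, transpose_Gjet₁, Matrix.mul_neg, Matrix.neg_mul,
    smul_neg, neg_neg, Matrix.mul_assoc]

/-- [folklore] PARITY TYPE: the mixed inverse jet is EVEN, `(A_st)ᵀ = A_st`. -/
theorem transpose_Ajet₁₁ : (Ajet₁₁ s b b' N)ᵀ = Ajet₁₁ s b b' N := by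
  have hG : ((Gjet₀ s N)⁻¹)ᵀ = (Gjet₀ s N)⁻¹ := by rw [Matrix.transpose_nonsing_inv, transpose_Gjet₀]
  rw [Ajet₁₁, Matrix.transpose_smul]
  congr 1
  simp only [Matrix.transpose_add, Matrix.transpose_neg, Matrix.transpose_mul, hG, transpose_Gjet₁, transpose_Gjet₁₁, Matrix.mul_neg,
    Matrix.neg_mul, neg_neg, Matrix.mul_assoc]
  abel

end CoframeParity

section Road

variable (m : ℕ) {a : ℝ} (p : ℕ) [NeZero p] {r : Fin 4 → ℕ}

/-- [folklore] **THE TWISTED «GRAM-COV» READING AT TB4-W's JETS + THE CONVENTION IS THE `Cgh` TOWER OF THE LANDED `ℤ⁴` FAMILIES** (`s = (m+1)·p`,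
`b = (σu, μ)`, `b′ = (σu′, ν)`, `|u−u′|₁ + 3 ≤ s`): under the ONE-SIDED WARD-L letters `hEₛ hEₜ hEₛₜ` (order 0 = `Khat_mul_What0`), with `B₀ = gram₀ T₀ A₀`,
TWISTED weight jets `B̃ₛ = tgram₁ T₀ Tₛ A₀ Aₛ`, `B̃ₛₜ = tgramMix T A` at `T• = Tjet• N̂ e₁`, `A• = Ajet• N̂`:
`hessT ((gram₀ Ŵ₀ (K̂+B₀))⁻¹; tgram₁ Ŵ₀ Wₛ (K̂+B₀) (kₛ+B̃ₛ), tgram₁ Ŵ₀ Wₜ (K̂+B₀) (kₜ+B̃ₜ), tgramMix …) = hessT ((Cgh (m+1) a)^; (arr Lgh μ u)^, (arr Lgh ν u′)^, (arr Lgh₂ μ u ν u′)^)`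
(§2 `K`-drop ∘ §1 `hessT_tgram_eq_gram` ∘ `KGramCovJets.hessT_gramCov_B_eq_Gjet` ∘ `hessT_Gjet_eq_Cgh_Lsq` ∘ `KCombineCovTowers.Lsq•_fst_eq_arr`) — the `bΦ`
slot of §3 for the literal, in the same array currency as `KCombineCovTowers` §1. -/
theorem hessT_tgramCov_What0_eq_arr (ha : 0 < a) (hr : r ∈ box 4 (m + 1)) (μ ν : Fin 4) (u u' : Fin 4 → ℤ)
    (hs : l1 (u - u') + 3 ≤ (((m + 1) * p : ℕ) : ℝ))
    (kₛ kₜ kₛₜ : Matrix (I 3 (m + 1) p) (I 3 (m + 1) p) ℝ)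
    {Wₛ Wₜ Wₛₜ : Matrix (I 3 (m + 1) p) (CombRows (toSite r) (m + 1) p) ℝ}
    (hWₛ : Wₛ = (Djet ((m + 1) * p) (siteOf 4 ((m + 1) * p) u, μ)).submatrix (e₁ (m + 1) p) id * Nhat r (m + 1) p)
    (hWₜ : Wₜ = (Djet ((m + 1) * p) (siteOf 4 ((m + 1) * p) u', ν)).submatrix (e₁ (m + 1) p) id * Nhat r (m + 1) p)
    (hWₛₜ : Wₛₜ = if (siteOf 4 ((m + 1) * p) u, μ) = (siteOf 4 ((m + 1) * p) u', ν)
      then (Djet ((m + 1) * p) (siteOf 4 ((m + 1) * p) u, μ)).submatrix (e₁ (m + 1) p) id * Nhat r (m + 1) p else 0)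
    (hEₛ : kₛ * What0 r (m + 1) p + Khat (d := 3) (m + 1) p * Wₛ = 0) (hEₜ : kₜ * What0 r (m + 1) p + Khat (d := 3) (m + 1) p * Wₜ = 0)
    (hEₛₜ : kₛₜ * What0 r (m + 1) p + kₛ * Wₜ + kₜ * Wₛ + Khat (d := 3) (m + 1) p * Wₛₜ = 0)
    {B₀ Bₛ Bₜ Bₛₜ : Matrix (I 3 (m + 1) p) (I 3 (m + 1) p) ℝ}
    (hB₀ : B₀ = gram₀ (Tjet₀ ((m + 1) * p) (Nhat r (m + 1) p) (e₁ (m + 1) p)) (Ajet₀ ((m + 1) * p) (Nhat r (m + 1) p)))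
    (hBₛ : Bₛ = tgram₁ (Tjet₀ ((m + 1) * p) (Nhat r (m + 1) p) (e₁ (m + 1) p))
      (Tjet₁ ((m + 1) * p) (siteOf 4 ((m + 1) * p) u, μ) (Nhat r (m + 1) p) (e₁ (m + 1) p))
      (Ajet₀ ((m + 1) * p) (Nhat r (m + 1) p)) (Ajet₁ ((m + 1) * p) (siteOf 4 ((m + 1) * p) u, μ) (Nhat r (m + 1) p)))
    (hBₜ : Bₜ = tgram₁ (Tjet₀ ((m + 1) * p) (Nhat r (m + 1) p) (e₁ (m + 1) p))
      (Tjet₁ ((m + 1) * p) (siteOf 4 ((m + 1) * p) u', ν) (Nhat r (m + 1) p) (e₁ (m + 1) p))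
      (Ajet₀ ((m + 1) * p) (Nhat r (m + 1) p)) (Ajet₁ ((m + 1) * p) (siteOf 4 ((m + 1) * p) u', ν) (Nhat r (m + 1) p)))
    (hBₛₜ : Bₛₜ = tgramMix (Tjet₀ ((m + 1) * p) (Nhat r (m + 1) p) (e₁ (m + 1) p))
      (Tjet₁ ((m + 1) * p) (siteOf 4 ((m + 1) * p) u, μ) (Nhat r (m + 1) p) (e₁ (m + 1) p))
      (Tjet₁ ((m + 1) * p) (siteOf 4 ((m + 1) * p) u', ν) (Nhat r (m + 1) p) (e₁ (m + 1) p))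
      (Tjet₁₁ ((m + 1) * p) (siteOf 4 ((m + 1) * p) u, μ) (siteOf 4 ((m + 1) * p) u', ν) (Nhat r (m + 1) p) (e₁ (m + 1) p))
      (Ajet₀ ((m + 1) * p) (Nhat r (m + 1) p)) (Ajet₁ ((m + 1) * p) (siteOf 4 ((m + 1) * p) u, μ) (Nhat r (m + 1) p))
      (Ajet₁ ((m + 1) * p) (siteOf 4 ((m + 1) * p) u', ν) (Nhat r (m + 1) p))
      (Ajet₁₁ ((m + 1) * p) (siteOf 4 ((m + 1) * p) u, μ) (siteOf 4 ((m + 1) * p) u', ν) (Nhat r (m + 1) p))) :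
    hessT (gram₀ (What0 r (m + 1) p) (Khat (d := 3) (m + 1) p + B₀))⁻¹
        (tgram₁ (What0 r (m + 1) p) Wₛ (Khat (d := 3) (m + 1) p + B₀) (kₛ + Bₛ))
        (tgram₁ (What0 r (m + 1) p) Wₜ (Khat (d := 3) (m + 1) p + B₀) (kₜ + Bₜ))
        (tgramMix (What0 r (m + 1) p) Wₛ Wₜ Wₛₜ (Khat (d := 3) (m + 1) p + B₀) (kₛ + Bₛ) (kₜ + Bₜ) (kₛₜ + Bₛₜ))
      = hessT (Matrix.of (periodiseF ((m + 1) * p) (toF (Cgh (m + 1) a))))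
          (Matrix.of (periodiseF ((m + 1) * p) (toF (arr ((m + 1) * p) (Lgh μ u)))))
          (Matrix.of (periodiseF ((m + 1) * p) (toF (arr ((m + 1) * p) (Lgh ν u')))))
          (Matrix.of (periodiseF ((m + 1) * p) (toF (arr ((m + 1) * p) (Lgh₂ μ u ν u'))))) := by
  have hE₀ : Khat (d := 3) (m + 1) p * What0 r (m + 1) p = 0 := Khat_mul_What0 r (m + 1) p hr
  rw [gram₀_add_of_wardL hE₀, tgram₁_add_eq_of_wardL hE₀ hEₛ, tgram₁_add_eq_of_wardL hE₀ hEₜ, tgramMix_add_eq_of_wardL hE₀ hEₛ hEₜ hEₛₜ,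
    hB₀, hBₛ, hBₜ, hBₛₜ, hessT_tgram_eq_gram _ _ _ _ _ _ _ _ _ _ _ _ (det_Tjet₀_mul_What0_ne_zero m p ha hr) (det_Ajet₀_Nhat_ne_zero m p ha hr),
    hessT_gramCov_B_eq_Gjet m p ha hr _ _ hWₛ hWₜ hWₛₜ, hessT_Gjet_eq_Cgh_Lsq m p ha hr, Lsq₁_fst_eq_arr, Lsq₁_fst_eq_arr,
    Lsq₁₁_fst_eq_arr _ μ ν u u' hs]

end Road

end Summit.QuantumFields.BalabanUV.Beta.D1BFx.KCombineCovColourTorus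

end
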